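import Summits.QuantumFields.YangMills.Theorems.GronwallGapAnalyticDetourExactCut
import Summits.QuantumFields.YangMills.Theorems.GronwallGapAnalyticDetourStubWilsonSegmentAdm
import Summits.QuantumFields.YangMills.Theorems.GronwallGapAnalyticDetourStubExpPosSemidef
import Summits.QuantumFields.YangMills.Theorems.GronwallGapAnalyticDetourPathCalculus

/-!
# Crux `AnalyticDetour` (stmt-QuantumFields-8801), line `registered`:
# the cycle-3 reshape is EXACT — `AnalyticDetour ↔ (A ∧ B)`

Route `GronwallGap`, sub-problem `YangMills`.  Cycle 3 (lead c2) split the open core of the crux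
(`stub_anchoredDetour`, itself equivalent to the crux: `stub_cutExact`) into two registered stubs:

* **A** (`stub_axisRegularOffLocallyFinite`): for every compact simple `G` and lattice representation
  `r` the Gateaux-singular Wilson couplings form a set that is locally finite on `[0, ∞)` — off some
  such `E`, the Wilson weight `exp(β Re tr r.ρ)`, `β > 0`, has Gateaux-analytic torus pressure in
  every continuous class direction (`AnP`);
* **B** (`stub_localBypass`): around every coupling `βc > 0` there is `δ > 0` such that any two
  REGULAR Wilson points `βm ∈ (βc − δ, βc)`, `βp ∈ (βc, βc + δ)`, `βm > 0`, are joined by an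
  admissible weight path with Gateaux-analytic pressure at every parameter.

This file proves that the split loses nothing:

* `axisRegularOffLocallyFinite_of_analyticDetour` : crux → A (the `s = 1` endpoint of the crux's
  own path to `β ∉ E` is the Wilson weight at `β`);
* `regularWilsonPointsJoined_of_analyticDetour` : crux → B⁺, the GLOBAL form of B (any two regular
  Wilson points of positive coupling are joined): every regular `β > 0` — even one inside the
  crux's exceptional set — is reached from the fixed start `β₁/2` (reach a non-exceptional
  `β' < β` with `[β', β)` free of `E`, then run the Wilson segment, regular on `[β', β)` by the
  endpoint argument and at `β` by hypothesis); reverse one such path and concatenate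
  (`reach_symm`, `reach_trans` of the path calculus);
* `localBypass_of_analyticDetour` : crux → B (from B⁺ with `δ := βc`);
* `anchoredDetour_of_bypass`, `analyticDetour_of_bypass` : A → B → anchored detour → crux (the
  skeleton's composition, importable: anchor `βa ∈ (0, b) ∖ E`, `chain_of_localBypass` over the
  finitely many exceptional points between anchor and target, Wilson segments on the `E`-free
  stretches, reversal for targets below the anchor; then the landed reduction
  `stub_reductionToAnchoredDetour`);
* `analyticDetour_iff_bypass` : crux ↔ (A ∧ B).

Consequences for the line.  Both stubs are NECESSARY, so neither can be refuted without refuting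
the crux, and promoting them to items is lossless; A is the Wilson-axis half ("bulk singularities
are isolated" — it is also the shape of the exceptional set of the route's target
`LatticeGapOffTransitions`), B the detour half proper ("no coupling is an unavoidable obstruction
inside the reflection-positive cone").  Pure logic on registered statements plus the landed
admissibility of Wilson segments; no named facts; no definitions.
-/

noncomputable section

namespace Summit.QuantumFields.YangMills.Theorems

open scoped BigOperators

/-- **crux → A.**  The route decl `AnalyticDetour` implies stub A (`stub_axisRegularOffLocallyFinite`, verbatim as registered): with the crux's `E`, `β₁` for `(G, r)`, the path from the start `β₁/2` to `β ∉ E` is Gateaux-regular at its endpoint `s = 1`, which is the Wilson weight at `β`. -/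
theorem axisRegularOffLocallyFinite_of_analyticDetour :
    Summit.QuantumFields.YangMills.Theses.GronwallGap.AnalyticDetour →
    (∀ (G : Type) [Group G] [TopologicalSpace G] [IsTopologicalGroup G] [CompactSpace G], Literature.MathematicalPhysics.QuantumFieldTheory.IsCompactSimpleLieGroup G → letI : MeasurableSpace G := borel G; haveI : BorelSpace G := ⟨rfl⟩; let Pseq : (G → ℝ) → ℕ → ℝ := fun v L => (((L + 1 : ℕ) : ℝ) ^ 4)⁻¹ * Real.log (((MeasureTheory.Measure.pi fun _ : Literature.MathematicalPhysics.QuantumFieldTheory.Edge 4 (L + 1) => Literature.MathematicalPhysics.QuantumFieldTheory.haarProbability G).withDensity (fun U : Literature.MathematicalPhysics.QuantumFieldTheory.GaugeConfig 4 (L + 1) G => ENNReal.ofReal (Literature.MathematicalPhysics.QuantumLattice.groupHeatKernelWeight (fun _ : ℝ => v) 0 U))) Set.univ).toReal; let AnP : (G → ℝ) → Prop := fun v => ∀ φ : G → ℝ, Continuous φ → (∀ g h : G, φ (h * g * h⁻¹) = φ g) → ∃ p : ℝ → ℝ, (∀ t : ℝ, Filter.Tendsto (fun L : ℕ => Pseq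 (fun g => v g * Real.exp (t * φ g)) L) Filter.atTop (nhds (p t))) ∧ AnalyticAt ℝ p 0; ∀ r : Literature.MathematicalPhysics.QuantumFieldTheory.LatticeRep G, ∃ E : Set ℝ, (∀ b : ℝ, (E ∩ Set.Icc 0 b).Finite) ∧ ∀ β : ℝ, 0 < β → β ∉ E → AnP (fun g => Real.exp (β * (r.ρ g).trace.re))) := by
  intro h G i1 i2 i3 i4 hG Pseq AnP r
  obtain ⟨E, hE, β₁, hβ₁, hpath⟩ := h G hG r
  refine ⟨E, hE, fun β hβ hβE => ?_⟩
  obtain ⟨w, _hAdm, hAn, _h0, h1⟩ := hpath β hβ hβE (β₁ / 2) ⟨by positivity, by linarith⟩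
  have hend := hAn 1 ⟨zero_le_one, le_rfl⟩
  rw [h1] at hend
  exact hend

/-- **crux → B⁺ (global joinability of regular Wilson points).**  Under `AnalyticDetour`, any two Wilson weights of positive coupling with Gateaux-regular pressure are joined by an admissible weight path with Gateaux-analytic pressure at every parameter.  Key step: every regular `β > 0` is reached from the start `β₁/2` — if `β ∈ E`, pick `β' ∈ (β/2, β)` with `[β', β)` free of `E` (`E ∩ [0, β]` is finite), reach `β'` by the crux and run the Wilson segment `β' ⇝ β` (admissible by `stub_wilsonSegmentAdm`; regular on `[β', β)` since those couplings are non-exceptional, at `β` by hypothesis); then reverse one path and concatenate. -/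
theorem regularWilsonPointsJoined_of_analyticDetour :
    Summit.QuantumFields.YangMills.Theses.GronwallGap.AnalyticDetour →
    (∀ (G : Type) [Group G] [TopologicalSpace G] [IsTopologicalGroup G] [CompactSpace G], Literature.MathematicalPhysics.QuantumFieldTheory.IsCompactSimpleLieGroup G → letI : MeasurableSpace G := borel G; haveI : BorelSpace G := ⟨rfl⟩; let Pseq : (G → ℝ) → ℕ → ℝ := fun v L => (((L + 1 : ℕ) : ℝ) ^ 4)⁻¹ * Real.log (((MeasureTheory.Measure.pi fun _ : Literature.MathematicalPhysics.QuantumFieldTheory.Edge 4 (L + 1) => Literature.MathematicalPhysics.QuantumFieldTheory.haarProbability G).withDensity (fun U : Literature.MathematicalPhysics.QuantumFieldTheory.GaugeConfig 4 (L + 1) G => ENNReal.ofReal (Literature.MathematicalPhysics.QuantumLattice.groupHeatKernelWeight (fun _ : ℝ => v) 0 U))) Set.univ).toReal; let AnP : (G → ℝ) → Prop := fun v => ∀ φ : G → ℝ, Continuous φ → (∀ g h : G, φ (h * g * h⁻¹) = φ g) → ∃ p : ℝ → ℝ, (∀ t : ℝ, Filter.Tendsto (fun L : ℕ => Pseq (fun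 g => v g * Real.exp (t * φ g)) L) Filter.atTop (nhds (p t))) ∧ AnalyticAt ℝ p 0; let Adm : (ℝ → G → ℝ) → Prop := fun w => (∀ s ∈ Set.Icc (0 : ℝ) 1, Continuous (w s) ∧ (∀ g : G, 0 < w s g) ∧ (∀ g h : G, w s (h * g * h⁻¹) = w s g) ∧ (∀ g : G, w s g⁻¹ = w s g) ∧ (∀ (n : ℕ) (x : Fin n → G) (c : Fin n → ℂ), 0 ≤ (∑ i, ∑ j, (starRingEnd ℂ) (c i) * c j * ((w s ((x i)⁻¹ * x j) : ℝ) : ℂ)).re)) ∧ ∃ Λ : ℝ, ∀ s ∈ Set.Icc (0 : ℝ) 1, ∀ s' ∈ Set.Icc (0 : ℝ) 1, ∀ g : G, |Real.log (w s g) - Real.log (w s' g)| ≤ Λ * |s - s'|; ∀ r : Literature.MathematicalPhysics.QuantumFieldTheory.LatticeRep G, ∀ βm βp : ℝ, 0 < βm → 0 < βp → AnP (fun g => Real.exp (βm * (r.ρ g).trace.re)) → AnP (fun g => Real.exp (βp * (r.ρ g).trace.re)) → ∃ w : ℝ → G → ℝ, Adm w ∧ (∀ s ∈ Set.Icc (0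 : ℝ) 1, AnP (w s)) ∧ w 0 = (fun g => Real.exp (βm * (r.ρ g).trace.re)) ∧ w 1 = (fun g => Real.exp (βp * (r.ρ g).trace.re))) := by
  intro h G i1 i2 i3 i4 hG Pseq AnP Adm r
  obtain ⟨E, hE, β₁, hβ₁, hpath⟩ := h G hG r
  have hβs : β₁ / 2 ∈ Set.Ioo (0 : ℝ) β₁ := ⟨by positivity, by linarith⟩
  -- regularity off `E` (endpoint argument)
  have hreg : ∀ β : ℝ, 0 < β → β ∉ E → AnP (fun g => Real.exp (β * (r.ρ g).trace.re)) := by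
    intro β hβ hβE
    obtain ⟨w, _hAdm, hAn, _h0, h1⟩ := hpath β hβ hβE (β₁ / 2) hβs
    have hend := hAn 1 ⟨zero_le_one, le_rfl⟩
    rw [h1] at hend
    exact hend
  -- every regular `β > 0` is reached from the start `β₁ / 2`
  have hreach : ∀ β : ℝ, 0 < β → AnP (fun g => Real.exp (β * (r.ρ g).trace.re)) →
      ∃ w : ℝ → G → ℝ, Adm w ∧ (∀ s ∈ Set.Icc (0 : ℝ) 1, AnP (w s)) ∧
        w 0 = (fun g => Real.exp (β₁ / 2 * (r.ρ g).trace.re)) ∧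
        w 1 = (fun g => Real.exp (β * (r.ρ g).trace.re)) := by
    intro β hβ hβreg
    by_cases hβE : β ∈ E
    · -- `β' ∈ (β/2, β)` with `[β', β)` free of exceptional points
      have hfin : (E ∩ Set.Ico (β / 2) β).Finite :=
        (hE β).subset fun t ht => ⟨ht.1, by linarith [ht.2.1], ht.2.2.le⟩
      obtain ⟨β', hβ'lo, hβ'hi, hfree⟩ :
          ∃ β' : ℝ, β / 2 < β' ∧ β' < β ∧ ∀ t ∈ Set.Ico β' β, t ∉ E := by
        by_cases hne : (E ∩ Set.Ico (β / 2) β).Nonempty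
        · obtain ⟨e, he, hemax⟩ := Set.exists_max_image (E ∩ Set.Ico (β / 2) β) id hfin hne
          obtain ⟨heE, helo, hehi⟩ := he
          refine ⟨(e + β) / 2, by linarith, by linarith, fun t ht htE => ?_⟩
          obtain ⟨ht1, ht2⟩ := ht
          have hte : t ≤ e := hemax t ⟨htE, by linarith, ht2⟩
          linarith
        · rw [Set.not_nonempty_iff_eq_empty] at hne
          refine ⟨3 * β / 4, by linarith, by linarith, fun t ht htE => ?_⟩
          obtain ⟨ht1, ht2⟩ := ht
          have hmem : t ∈ E ∩ Set.Ico (β / 2) β := ⟨htE, by linarith, ht2⟩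
          rw [hne] at hmem
          exact hmem
      have hβ'0 : 0 < β' := by linarith
      have hβ'E : β' ∉ E := hfree β' ⟨le_rfl, hβ'hi⟩
      obtain ⟨w₁, hAdm₁, hAn₁, h₁0, h₁1⟩ := hpath β' hβ'0 hβ'E (β₁ / 2) hβs
      -- the Wilson segment `β' ⇝ β`
      have hAdm₂ := stub_wilsonSegmentAdm stub_expPosSemidef G hG r β' β hβ'0.le hβ.le
      have hAn₂ : ∀ s ∈ Set.Icc (0 : ℝ) 1,
          AnP (fun g => Real.exp (((1 - s) * β' + s * β) * (r.ρ g).trace.re)) := by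
        intro s hs
        obtain ⟨hs0, hs1⟩ := hs
        rcases eq_or_lt_of_le hs1 with hs1' | hs1'
        · rw [hs1']
          have e : (fun g => Real.exp (((1 - 1) * β' + 1 * β) * (r.ρ g).trace.re)) =
              (fun g => Real.exp (β * (r.ρ g).trace.re)) := by
            funext g
            norm_num
          rw [e]
          exact hβreg
        · have hlo : β' ≤ (1 - s) * β' + s * β := by nlinarith
          have hhi : (1 - s) * β' + s * β < β := by nlinarith
          exact hreg _ (lt_of_lt_of_le hβ'0 hlo) (hfree _ ⟨hlo, hhi⟩)
      have h₂0 : (fun s g => Real.exp (((1 - s) * β' + s * β) * (r.ρ g).trace.re)) 0 =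
          (fun g => Real.exp (β' * (r.ρ g).trace.re)) := by
        funext g
        norm_num
      have h₂1 : (fun s g => Real.exp (((1 - s) * β' + s * β) * (r.ρ g).trace.re)) 1 =
          (fun g => Real.exp (β * (r.ρ g).trace.re)) := by
        funext g
        norm_num
      obtain ⟨w, hP, hL, h0, h1⟩ := reach_trans (fun v : G → ℝ => (Continuous v ∧ (∀ g : G, 0 < v g) ∧ (∀ g h : G, v (h * g * h⁻¹) = v g) ∧ (∀ g : G, v g⁻¹ = v g) ∧ (∀ (n : ℕ) (x : Fin n → G) (c : Fin n → ℂ), 0 ≤ (∑ i, ∑ j, (starRingEnd ℂ) (c i) * c j * ((v ((x i)⁻¹ * x j) : ℝ) : ℂ)).re)) ∧ AnP v)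
        ⟨w₁, fun s hs => ⟨hAdm₁.1 s hs, hAn₁ s hs⟩, hAdm₁.2, h₁0, h₁1⟩
        ⟨fun s g => Real.exp (((1 - s) * β' + s * β) * (r.ρ g).trace.re),
          fun s hs => ⟨hAdm₂.1 s hs, hAn₂ s hs⟩, hAdm₂.2, h₂0, h₂1⟩
      exact ⟨w, And.intro (fun s hs => (hP s hs).1) hL, fun s hs => (hP s hs).2, h0, h1⟩
    · exact hpath β hβ hβE (β₁ / 2) hβs
  -- reverse the path to `βm`, concatenate with the path to `βp`
  intro βm βp hm hp hAm hAp
  obtain ⟨w₁, hAdm₁, hAn₁, h₁0, h₁1⟩ := hreach βm hm hAm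
  obtain ⟨w₂, hAdm₂, hAn₂, h₂0, h₂1⟩ := hreach βp hp hAp
  obtain ⟨w₁', hP₁', hL₁', h₁0', h₁1'⟩ := reach_symm (fun v : G → ℝ => (Continuous v ∧ (∀ g : G, 0 < v g) ∧ (∀ g h : G, v (h * g * h⁻¹) = v g) ∧ (∀ g : G, v g⁻¹ = v g) ∧ (∀ (n : ℕ) (x : Fin n → G) (c : Fin n → ℂ), 0 ≤ (∑ i, ∑ j, (starRingEnd ℂ) (c i) * c j * ((v ((x i)⁻¹ * x j) : ℝ) : ℂ)).re)) ∧ AnP v)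
    ⟨w₁, fun s hs => ⟨hAdm₁.1 s hs, hAn₁ s hs⟩, hAdm₁.2, h₁0, h₁1⟩
  obtain ⟨w, hP, hL, h0, h1⟩ := reach_trans (fun v : G → ℝ => (Continuous v ∧ (∀ g : G, 0 < v g) ∧ (∀ g h : G, v (h * g * h⁻¹) = v g) ∧ (∀ g : G, v g⁻¹ = v g) ∧ (∀ (n : ℕ) (x : Fin n → G) (c : Fin n → ℂ), 0 ≤ (∑ i, ∑ j, (starRingEnd ℂ) (c i) * c j * ((v ((x i)⁻¹ * x j) : ℝ) : ℂ)).re)) ∧ AnP v)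
    ⟨w₁', hP₁', hL₁', h₁0', h₁1'⟩
    ⟨w₂, fun s hs => ⟨hAdm₂.1 s hs, hAn₂ s hs⟩, hAdm₂.2, h₂0, h₂1⟩
  exact ⟨w, And.intro (fun s hs => (hP s hs).1) hL, fun s hs => (hP s hs).2, h0, h1⟩

/-- **crux → B.**  The route decl `AnalyticDetour` implies stub B (`stub_localBypass`, verbatim as registered): the local bypass is a special case of the global joinability of regular Wilson points (`δ := βc`). -/
theorem localBypass_of_analyticDetour :
    Summit.QuantumFields.YangMills.Theses.GronwallGap.AnalyticDetour →
    (∀ (G : Type) [Group G] [TopologicalSpace G] [IsTopologicalGroup G] [CompactSpace G], Literature.MathematicalPhysics.QuantumFieldTheory.IsCompactSimpleLieGroup G → letI : MeasurableSpace G := borel G; haveI : BorelSpace G := ⟨rfl⟩; let Pseq : (G → ℝ) → ℕ → ℝ := fun v L => (((L + 1 : ℕ) : ℝ) ^ 4)⁻¹ * Real.log (((MeasureTheory.Measure.pi fun _ : Literature.MathematicalPhysics.QuantumFieldTheory.Edge 4 (L + 1) => Literature.MathematicalPhysics.QuantumFieldTheory.haarProbability G).withDensity (fun U : Literature.MathematicalPhysics.QuantumFieldTheory.GaugeConfig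 4 (L + 1) G => ENNReal.ofReal (Literature.MathematicalPhysics.QuantumLattice.groupHeatKernelWeight (fun _ : ℝ => v) 0 U))) Set.univ).toReal; let AnP : (G → ℝ) → Prop := fun v => ∀ φ : G → ℝ, Continuous φ → (∀ g h : G, φ (h * g * h⁻¹) = φ g) → ∃ p : ℝ → ℝ, (∀ t : ℝ, Filter.Tendsto (fun L : ℕ => Pseq (fun g => v g * Real.exp (t * φ g)) L) Filter.atTop (nhds (p t))) ∧ AnalyticAt ℝ p 0; let Adm : (ℝ → G → ℝ) → Prop := fun w => (∀ s ∈ Set.Icc (0 : ℝ) 1, Continuous (w s) ∧ (∀ g : G, 0 < w s g) ∧ (∀ g h : G, w s (h * g * h⁻¹) = w s g) ∧ (∀ g : G, w s g⁻¹ = w s g) ∧ (∀ (n : ℕ) (x : Fin n → G) (c : Fin n → ℂ), 0 ≤ (∑ i, ∑ j, (starRingEnd ℂ) (c i) * c j * ((w s ((x i)⁻¹ * x j) : ℝ) : ℂ)).re)) ∧ ∃ Λ : ℝ, ∀ s ∈ Set.Icc (0 : ℝ) 1, ∀ s' ∈ Set.Icc (0 : ℝ) 1, ∀ g : G, |Real.log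 (w s g) - Real.log (w s' g)| ≤ Λ * |s - s'|; ∀ r : Literature.MathematicalPhysics.QuantumFieldTheory.LatticeRep G, ∀ βc : ℝ, 0 < βc → ∃ δ : ℝ, 0 < δ ∧ ∀ βm ∈ Set.Ioo (βc - δ) βc, ∀ βp ∈ Set.Ioo βc (βc + δ), 0 < βm → AnP (fun g => Real.exp (βm * (r.ρ g).trace.re)) → AnP (fun g => Real.exp (βp * (r.ρ g).trace.re)) → ∃ w : ℝ → G → ℝ, Adm w ∧ (∀ s ∈ Set.Icc (0 : ℝ) 1, AnP (w s)) ∧ w 0 = (fun g => Real.exp (βm * (r.ρ g).trace.re)) ∧ w 1 = (fun g => Real.exp (βp * (r.ρ g).trace.re))) := by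
  intro h G i1 i2 i3 i4 hG Pseq AnP Adm r βc hβc
  refine ⟨βc, hβc, fun βm hm βp hp hm0 hAm hAp => ?_⟩
  have hp0 : 0 < βp := hβc.trans hp.1
  exact regularWilsonPointsJoined_of_analyticDetour h G hG r βm βp hm0 hp0 hAm hAp

/-- **A → B → the anchored detour** (the skeleton's cycle-3 composition, importable).  `E` from A; anchor `βa ∈ (0, b) ∖ E`; for `β ∉ E` with `βa ≤ β`, `chain_of_localBypass` for the relation "Wilson(`a`) is joined to Wilson(`b`)": transitive by concatenation, true along `E`-free segments `[a, b] ⊂ (0, ∞)` (Wilson segment, admissible by `stub_wilsonSegmentAdm`, regular by A), with local bypasses from B (endpoint regularity by A); reversed when `β < βa`. -/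
theorem anchoredDetour_of_bypass :
    (∀ (G : Type) [Group G] [TopologicalSpace G] [IsTopologicalGroup G] [CompactSpace G], Literature.MathematicalPhysics.QuantumFieldTheory.IsCompactSimpleLieGroup G → letI : MeasurableSpace G := borel G; haveI : BorelSpace G := ⟨rfl⟩; let Pseq : (G → ℝ) → ℕ → ℝ := fun v L => (((L + 1 : ℕ) : ℝ) ^ 4)⁻¹ * Real.log (((MeasureTheory.Measure.pi fun _ : Literature.MathematicalPhysics.QuantumFieldTheory.Edge 4 (L + 1) => Literature.MathematicalPhysics.QuantumFieldTheory.haarProbability G).withDensity (fun U : Literature.MathematicalPhysics.QuantumFieldTheory.GaugeConfig 4 (L + 1) G => ENNReal.ofReal (Literature.MathematicalPhysics.QuantumLattice.groupHeatKernelWeight (fun _ : ℝ => v) 0 U))) Set.univ).toReal; let AnP : (G → ℝ) → Prop := fun v => ∀ φ : G → ℝ, Continuous φ → (∀ g h : G, φ (h * g * h⁻¹) = φ g) → ∃ p : ℝ → ℝ, (∀ t : ℝ, Filter.Tendsto (fun L : ℕ => Pseq (fun g => v g * Real.exp (t * φ g)) L) Filter.atTop (nhds (p t))) ∧ AnalyticAt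 ℝ p 0; ∀ r : Literature.MathematicalPhysics.QuantumFieldTheory.LatticeRep G, ∃ E : Set ℝ, (∀ b : ℝ, (E ∩ Set.Icc 0 b).Finite) ∧ ∀ β : ℝ, 0 < β → β ∉ E → AnP (fun g => Real.exp (β * (r.ρ g).trace.re))) →
    (∀ (G : Type) [Group G] [TopologicalSpace G] [IsTopologicalGroup G] [CompactSpace G], Literature.MathematicalPhysics.QuantumFieldTheory.IsCompactSimpleLieGroup G → letI : MeasurableSpace G := borel G; haveI : BorelSpace G := ⟨rfl⟩; let Pseq : (G → ℝ) → ℕ → ℝ := fun v L => (((L + 1 : ℕ) : ℝ) ^ 4)⁻¹ * Real.log (((MeasureTheory.Measure.pi fun _ : Literature.MathematicalPhysics.QuantumFieldTheory.Edge 4 (L + 1) => Literature.MathematicalPhysics.QuantumFieldTheory.haarProbability G).withDensity (fun U : Literature.MathematicalPhysics.QuantumFieldTheory.GaugeConfig 4 (L + 1) G => ENNReal.ofReal (Literature.MathematicalPhysics.QuantumLattice.groupHeatKernelWeight (fun _ : ℝ => v) 0 U))) Set.univ).toReal; let AnP : (G → ℝ) → Prop := fun v => ∀ φ : G → ℝ,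 Continuous φ → (∀ g h : G, φ (h * g * h⁻¹) = φ g) → ∃ p : ℝ → ℝ, (∀ t : ℝ, Filter.Tendsto (fun L : ℕ => Pseq (fun g => v g * Real.exp (t * φ g)) L) Filter.atTop (nhds (p t))) ∧ AnalyticAt ℝ p 0; let Adm : (ℝ → G → ℝ) → Prop := fun w => (∀ s ∈ Set.Icc (0 : ℝ) 1, Continuous (w s) ∧ (∀ g : G, 0 < w s g) ∧ (∀ g h : G, w s (h * g * h⁻¹) = w s g) ∧ (∀ g : G, w s g⁻¹ = w s g) ∧ (∀ (n : ℕ) (x : Fin n → G) (c : Fin n → ℂ), 0 ≤ (∑ i, ∑ j, (starRingEnd ℂ) (c i) * c j * ((w s ((x i)⁻¹ * x j) : ℝ) : ℂ)).re)) ∧ ∃ Λ : ℝ, ∀ s ∈ Set.Icc (0 : ℝ) 1, ∀ s' ∈ Set.Icc (0 : ℝ) 1, ∀ g : G, |Real.log (w s g) - Real.log (w s' g)| ≤ Λ * |s - s'|; ∀ r : Literature.MathematicalPhysics.QuantumFieldTheory.LatticeRep G, ∀ βc : ℝ, 0 < βc → ∃ δ : ℝ, 0 < δ ∧ ∀ βm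 ∈ Set.Ioo (βc - δ) βc, ∀ βp ∈ Set.Ioo βc (βc + δ), 0 < βm → AnP (fun g => Real.exp (βm * (r.ρ g).trace.re)) → AnP (fun g => Real.exp (βp * (r.ρ g).trace.re)) → ∃ w : ℝ → G → ℝ, Adm w ∧ (∀ s ∈ Set.Icc (0 : ℝ) 1, AnP (w s)) ∧ w 0 = (fun g => Real.exp (βm * (r.ρ g).trace.re)) ∧ w 1 = (fun g => Real.exp (βp * (r.ρ g).trace.re))) →
    (∀ (G : Type) [Group G] [TopologicalSpace G] [IsTopologicalGroup G] [CompactSpace G], Literature.MathematicalPhysics.QuantumFieldTheory.IsCompactSimpleLieGroup G → letI : MeasurableSpace G := borel G; haveI : BorelSpace G := ⟨rfl⟩; let Pseq : (G → ℝ) → ℕ → ℝ := fun v L => (((L + 1 : ℕ) : ℝ) ^ 4)⁻¹ * Real.log (((MeasureTheory.Measure.pi fun _ : Literature.MathematicalPhysics.QuantumFieldTheory.Edge 4 (L + 1) => Literature.MathematicalPhysics.QuantumFieldTheory.haarProbability G).withDensity (fun U : Literature.MathematicalPhysics.QuantumFieldTheory.GaugeConfig 4 (L + 1) G => ENNReal.ofReal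 (Literature.MathematicalPhysics.QuantumLattice.groupHeatKernelWeight (fun _ : ℝ => v) 0 U))) Set.univ).toReal; let AnP : (G → ℝ) → Prop := fun v => ∀ φ : G → ℝ, Continuous φ → (∀ g h : G, φ (h * g * h⁻¹) = φ g) → ∃ p : ℝ → ℝ, (∀ t : ℝ, Filter.Tendsto (fun L : ℕ => Pseq (fun g => v g * Real.exp (t * φ g)) L) Filter.atTop (nhds (p t))) ∧ AnalyticAt ℝ p 0; let Adm : (ℝ → G → ℝ) → Prop := fun w => (∀ s ∈ Set.Icc (0 : ℝ) 1, Continuous (w s) ∧ (∀ g : G, 0 < w s g) ∧ (∀ g h : G, w s (h * g * h⁻¹) = w s g) ∧ (∀ g : G, w s g⁻¹ = w s g) ∧ (∀ (n : ℕ) (x : Fin n → G) (c : Fin n → ℂ), 0 ≤ (∑ i, ∑ j, (starRingEnd ℂ) (c i) * c j * ((w s ((x i)⁻¹ * x j) : ℝ) : ℂ)).re)) ∧ ∃ Λ : ℝ, ∀ s ∈ Set.Icc (0 : ℝ) 1, ∀ s' ∈ Set.Icc (0 : ℝ) 1, ∀ g : G, |Real.log (w s g) - Real.log (w s' g)| ≤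 Λ * |s - s'|; ∀ r : Literature.MathematicalPhysics.QuantumFieldTheory.LatticeRep G, ∃ E : Set ℝ, (∀ b : ℝ, (E ∩ Set.Icc 0 b).Finite) ∧ ∀ b : ℝ, 0 < b → ∃ βa ∈ Set.Ioo (0 : ℝ) b, ∀ β : ℝ, 0 < β → β ∉ E → ∃ w : ℝ → G → ℝ, Adm w ∧ (∀ s ∈ Set.Icc (0 : ℝ) 1, AnP (w s)) ∧ w 0 = (fun g => Real.exp (βa * (r.ρ g).trace.re)) ∧ w 1 = (fun g => Real.exp (β * (r.ρ g).trace.re))) := by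
  intro hA hB G i1 i2 i3 i4 hG Pseq AnP Adm r
  obtain ⟨E, hE, hreg⟩ := hA G hG r
  have hbyp := hB G hG r
  have key : ∀ a b : ℝ, 0 < a → a ≤ b → a ∉ E → b ∉ E →
      ∃ w : ℝ → G → ℝ, Adm w ∧ (∀ s ∈ Set.Icc (0 : ℝ) 1, AnP (w s)) ∧
        w 0 = (fun g => Real.exp (a * (r.ρ g).trace.re)) ∧
        w 1 = (fun g => Real.exp (b * (r.ρ g).trace.re)) := by
    refine chain_of_localBypass hE
      (fun a b => ∃ w : ℝ → G → ℝ, Adm w ∧ (∀ s ∈ Set.Icc (0 : ℝ) 1, AnP (w s)) ∧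
        w 0 = (fun g => Real.exp (a * (r.ρ g).trace.re)) ∧
        w 1 = (fun g => Real.exp (b * (r.ρ g).trace.re))) ?_ ?_ ?_
    · intro a b c hab hbc
      obtain ⟨w₁, hAdm₁, hAn₁, h₁0, h₁1⟩ := hab
      obtain ⟨w₂, hAdm₂, hAn₂, h₂0, h₂1⟩ := hbc
      obtain ⟨w, hP, hL, h0, h1⟩ := reach_trans (fun v : G → ℝ => (Continuous v ∧ (∀ g : G, 0 < v g) ∧ (∀ g h : G, v (h * g * h⁻¹) = v g) ∧ (∀ g : G, v g⁻¹ = v g) ∧ (∀ (n : ℕ) (x : Fin n → G) (c : Fin n → ℂ), 0 ≤ (∑ i, ∑ j, (starRingEnd ℂ) (c i) * c j * ((v ((x i)⁻¹ * x j) : ℝ) : ℂ)).re)) ∧ AnP v)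
        ⟨w₁, fun s hs => ⟨hAdm₁.1 s hs, hAn₁ s hs⟩, hAdm₁.2, h₁0, h₁1⟩
        ⟨w₂, fun s hs => ⟨hAdm₂.1 s hs, hAn₂ s hs⟩, hAdm₂.2, h₂0, h₂1⟩
      exact ⟨w, And.intro (fun s hs => (hP s hs).1) hL, fun s hs => (hP s hs).2, h0, h1⟩
    · intro a b ha hab hfree
      refine ⟨fun s g => Real.exp (((1 - s) * a + s * b) * (r.ρ g).trace.re),
        stub_wilsonSegmentAdm stub_expPosSemidef G hG r a b ha.le (ha.le.trans hab), ?_, ?_, ?_⟩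
      · intro s hs
        obtain ⟨hs0, hs1⟩ := hs
        have hlo : a ≤ (1 - s) * a + s * b := by nlinarith
        have hhi : (1 - s) * a + s * b ≤ b := by nlinarith
        exact hreg _ (lt_of_lt_of_le ha hlo) (hfree _ ⟨hlo, hhi⟩)
      · funext g
        norm_num
      · funext g
        norm_num
    · intro c hc
      obtain ⟨δ, hδ, hB'⟩ := hbyp c hc
      exact ⟨δ, hδ, fun m hm p hp hm0 hmE hpE =>
        hB' m hm p hp hm0 (hreg m hm0 hmE) (hreg p (hc.trans hp.1) hpE)⟩
  refine ⟨E, hE, fun b hb => ?_⟩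
  have hInf : (Set.Ioo 0 b \ (E ∩ Set.Icc 0 b)).Infinite := (Set.Ioo_infinite hb).sdiff (hE b)
  obtain ⟨βa, ⟨hβa0, hβab⟩, hβaE'⟩ := hInf.nonempty
  have hβaE : βa ∉ E := fun h => hβaE' ⟨h, hβa0.le, hβab.le⟩
  refine ⟨βa, ⟨hβa0, hβab⟩, fun β hβ hβE => ?_⟩
  rcases le_total βa β with hle | hle
  · exact key βa β hβa0 hle hβaE hβE
  · obtain ⟨w, hAdm, hAn, h0, h1⟩ := key β βa hβ hle hβE hβaE
    obtain ⟨w', hP, hL, h0', h1'⟩ := reach_symm (fun v : G → ℝ => (Continuous v ∧ (∀ g : G, 0 < v g) ∧ (∀ g h : G, v (h * g * h⁻¹) = v g) ∧ (∀ g : G, v g⁻¹ = v g) ∧ (∀ (n : ℕ) (x : Fin n → G) (c : Fin n → ℂ), 0 ≤ (∑ i, ∑ j, (starRingEnd ℂ) (c i) * c j * ((v ((x i)⁻¹ * x j) : ℝ) : ℂ)).re)) ∧ AnP v)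
      ⟨w, fun s hs => ⟨hAdm.1 s hs, hAn s hs⟩, hAdm.2, h0, h1⟩
    exact ⟨w', And.intro (fun s hs => (hP s hs).1) hL, fun s hs => (hP s hs).2, h0', h1'⟩

/-- **A → B → crux.**  The two cycle-3 stubs imply the route decl `AnalyticDetour` (anchored detour, then the landed reduction `stub_reductionToAnchoredDetour` through the strong-coupling window).  CONDITIONAL on A and B (both open); closes nothing by itself. -/
theorem analyticDetour_of_bypass :
    (∀ (G : Type) [Group G] [TopologicalSpace G] [IsTopologicalGroup G] [CompactSpace G], Literature.MathematicalPhysics.QuantumFieldTheory.IsCompactSimpleLieGroup G → letI : MeasurableSpace G := borel G; haveI : BorelSpace G := ⟨rfl⟩; let Pseq : (G → ℝ) → ℕ → ℝ := fun v L => (((L + 1 : ℕ) : ℝ) ^ 4)⁻¹ * Real.log (((MeasureTheory.Measure.pi fun _ : Literature.MathematicalPhysics.QuantumFieldTheory.Edge 4 (L + 1) => Literature.MathematicalPhysics.QuantumFieldTheory.haarProbability G).withDensity (fun U : Literature.MathematicalPhysics.QuantumFieldTheory.GaugeConfig 4 (L + 1) G => ENNReal.ofReal (Literature.MathematicalPhysics.QuantumLattice.groupHeatKernelWeight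 (fun _ : ℝ => v) 0 U))) Set.univ).toReal; let AnP : (G → ℝ) → Prop := fun v => ∀ φ : G → ℝ, Continuous φ → (∀ g h : G, φ (h * g * h⁻¹) = φ g) → ∃ p : ℝ → ℝ, (∀ t : ℝ, Filter.Tendsto (fun L : ℕ => Pseq (fun g => v g * Real.exp (t * φ g)) L) Filter.atTop (nhds (p t))) ∧ AnalyticAt ℝ p 0; ∀ r : Literature.MathematicalPhysics.QuantumFieldTheory.LatticeRep G, ∃ E : Set ℝ, (∀ b : ℝ, (E ∩ Set.Icc 0 b).Finite) ∧ ∀ β : ℝ, 0 < β → β ∉ E → AnP (fun g => Real.exp (β * (r.ρ g).trace.re))) →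
    (∀ (G : Type) [Group G] [TopologicalSpace G] [IsTopologicalGroup G] [CompactSpace G], Literature.MathematicalPhysics.QuantumFieldTheory.IsCompactSimpleLieGroup G → letI : MeasurableSpace G := borel G; haveI : BorelSpace G := ⟨rfl⟩; let Pseq : (G → ℝ) → ℕ → ℝ := fun v L => (((L + 1 : ℕ) : ℝ) ^ 4)⁻¹ * Real.log (((MeasureTheory.Measure.pi fun _ : Literature.MathematicalPhysics.QuantumFieldTheory.Edge 4 (L + 1) => Literature.MathematicalPhysics.QuantumFieldTheory.haarProbability G).withDensity (fun U : Literature.MathematicalPhysics.QuantumFieldTheory.GaugeConfig 4 (L + 1) G => ENNReal.ofReal (Literature.MathematicalPhysics.QuantumLattice.groupHeatKernelWeight (fun _ : ℝ => v) 0 U))) Set.univ).toReal; let AnP : (G → ℝ) → Prop := fun v => ∀ φ : G → ℝ, Continuous φ → (∀ g h : G, φ (h * g * h⁻¹) = φ g) → ∃ p : ℝ → ℝ, (∀ t : ℝ, Filter.Tendsto (fun L : ℕ => Pseq (fun g => v g * Real.exp (t * φ g)) L) Filter.atTop (nhds (p t))) ∧ AnalyticAt ℝ p 0; let Adm : (ℝ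 → G → ℝ) → Prop := fun w => (∀ s ∈ Set.Icc (0 : ℝ) 1, Continuous (w s) ∧ (∀ g : G, 0 < w s g) ∧ (∀ g h : G, w s (h * g * h⁻¹) = w s g) ∧ (∀ g : G, w s g⁻¹ = w s g) ∧ (∀ (n : ℕ) (x : Fin n → G) (c : Fin n → ℂ), 0 ≤ (∑ i, ∑ j, (starRingEnd ℂ) (c i) * c j * ((w s ((x i)⁻¹ * x j) : ℝ) : ℂ)).re)) ∧ ∃ Λ : ℝ, ∀ s ∈ Set.Icc (0 : ℝ) 1, ∀ s' ∈ Set.Icc (0 : ℝ) 1, ∀ g : G, |Real.log (w s g) - Real.log (w s' g)| ≤ Λ * |s - s'|; ∀ r : Literature.MathematicalPhysics.QuantumFieldTheory.LatticeRep G, ∀ βc : ℝ, 0 < βc → ∃ δ : ℝ, 0 < δ ∧ ∀ βm ∈ Set.Ioo (βc - δ) βc, ∀ βp ∈ Set.Ioo βc (βc + δ), 0 < βm → AnP (fun g => Real.exp (βm * (r.ρ g).trace.re)) → AnP (fun g => Real.exp (βp * (r.ρ g).trace.re)) → ∃ w : ℝ → G → ℝ, Adm w ∧ (∀ s ∈ Set.Icc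 (0 : ℝ) 1, AnP (w s)) ∧ w 0 = (fun g => Real.exp (βm * (r.ρ g).trace.re)) ∧ w 1 = (fun g => Real.exp (βp * (r.ρ g).trace.re))) →
    Summit.QuantumFields.YangMills.Theses.GronwallGap.AnalyticDetour :=
  fun hA hB => stub_reductionToAnchoredDetour (anchoredDetour_of_bypass hA hB)

/-- **The cycle-3 reshape is exact: `AnalyticDetour ↔ (A ∧ B)`.**  Both registered stubs are necessary conditions of the crux and together they are sufficient; promotion of either to an item is lossless. -/
theorem analyticDetour_iff_bypass :
    Summit.QuantumFields.YangMills.Theses.GronwallGap.AnalyticDetour ↔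
    ((∀ (G : Type) [Group G] [TopologicalSpace G] [IsTopologicalGroup G] [CompactSpace G], Literature.MathematicalPhysics.QuantumFieldTheory.IsCompactSimpleLieGroup G → letI : MeasurableSpace G := borel G; haveI : BorelSpace G := ⟨rfl⟩; let Pseq : (G → ℝ) → ℕ → ℝ := fun v L => (((L + 1 : ℕ) : ℝ) ^ 4)⁻¹ * Real.log (((MeasureTheory.Measure.pi fun _ : Literature.MathematicalPhysics.QuantumFieldTheory.Edge 4 (L + 1) => Literature.MathematicalPhysics.QuantumFieldTheory.haarProbability G).withDensity (fun U : Literature.MathematicalPhysics.QuantumFieldTheory.GaugeConfig 4 (L + 1) G => ENNReal.ofReal (Literature.MathematicalPhysics.QuantumLattice.groupHeatKernelWeight (fun _ : ℝ => v) 0 U))) Set.univ).toReal; let AnP : (G → ℝ) → Prop := fun v => ∀ φ : G → ℝ, Continuous φ → (∀ g h : G, φ (h * g * h⁻¹) = φ g) → ∃ p : ℝ → ℝ, (∀ t : ℝ, Filter.Tendsto (fun L : ℕ => Pseq (fun g => v g * Real.exp (t * φ g)) L) Filter.atTop (nhds (p t))) ∧ AnalyticAt ℝ p 0; ∀ r :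 Literature.MathematicalPhysics.QuantumFieldTheory.LatticeRep G, ∃ E : Set ℝ, (∀ b : ℝ, (E ∩ Set.Icc 0 b).Finite) ∧ ∀ β : ℝ, 0 < β → β ∉ E → AnP (fun g => Real.exp (β * (r.ρ g).trace.re))) ∧
     (∀ (G : Type) [Group G] [TopologicalSpace G] [IsTopologicalGroup G] [CompactSpace G], Literature.MathematicalPhysics.QuantumFieldTheory.IsCompactSimpleLieGroup G → letI : MeasurableSpace G := borel G; haveI : BorelSpace G := ⟨rfl⟩; let Pseq : (G → ℝ) → ℕ → ℝ := fun v L => (((L + 1 : ℕ) : ℝ) ^ 4)⁻¹ * Real.log (((MeasureTheory.Measure.pi fun _ : Literature.MathematicalPhysics.QuantumFieldTheory.Edge 4 (L + 1) => Literature.MathematicalPhysics.QuantumFieldTheory.haarProbability G).withDensity (fun U : Literature.MathematicalPhysics.QuantumFieldTheory.GaugeConfig 4 (L + 1) G => ENNReal.ofReal (Literature.MathematicalPhysics.QuantumLattice.groupHeatKernelWeight (fun _ : ℝ => v) 0 U))) Set.univ).toReal; let AnP : (G → ℝ) → Prop := fun v => ∀ φ : G → ℝ, Continuous φ → (∀ g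 h : G, φ (h * g * h⁻¹) = φ g) → ∃ p : ℝ → ℝ, (∀ t : ℝ, Filter.Tendsto (fun L : ℕ => Pseq (fun g => v g * Real.exp (t * φ g)) L) Filter.atTop (nhds (p t))) ∧ AnalyticAt ℝ p 0; let Adm : (ℝ → G → ℝ) → Prop := fun w => (∀ s ∈ Set.Icc (0 : ℝ) 1, Continuous (w s) ∧ (∀ g : G, 0 < w s g) ∧ (∀ g h : G, w s (h * g * h⁻¹) = w s g) ∧ (∀ g : G, w s g⁻¹ = w s g) ∧ (∀ (n : ℕ) (x : Fin n → G) (c : Fin n → ℂ), 0 ≤ (∑ i, ∑ j, (starRingEnd ℂ) (c i) * c j * ((w s ((x i)⁻¹ * x j) : ℝ) : ℂ)).re)) ∧ ∃ Λ : ℝ, ∀ s ∈ Set.Icc (0 : ℝ) 1, ∀ s' ∈ Set.Icc (0 : ℝ) 1, ∀ g : G, |Real.log (w s g) - Real.log (w s' g)| ≤ Λ * |s - s'|; ∀ r : Literature.MathematicalPhysics.QuantumFieldTheory.LatticeRep G, ∀ βc : ℝ, 0 < βc → ∃ δ : ℝ, 0 < δ ∧ ∀ βm ∈ Set.Ioo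 (βc - δ) βc, ∀ βp ∈ Set.Ioo βc (βc + δ), 0 < βm → AnP (fun g => Real.exp (βm * (r.ρ g).trace.re)) → AnP (fun g => Real.exp (βp * (r.ρ g).trace.re)) → ∃ w : ℝ → G → ℝ, Adm w ∧ (∀ s ∈ Set.Icc (0 : ℝ) 1, AnP (w s)) ∧ w 0 = (fun g => Real.exp (βm * (r.ρ g).trace.re)) ∧ w 1 = (fun g => Real.exp (βp * (r.ρ g).trace.re)))) :=
  ⟨fun h => ⟨axisRegularOffLocallyFinite_of_analyticDetour h, localBypass_of_analyticDetour h⟩,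
    fun h => analyticDetour_of_bypass h.1 h.2⟩

end Summit.QuantumFields.YangMills.Theorems

end
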